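import Summits.QuantumFields.YangMills.Theorems.BalabanUVNodesN19AgeScaleTransportBudget
import Summits.QuantumFields.YangMills.Theorems.BalabanUVNodesN19CoreScaleChain
import Summits.QuantumFields.YangMills.Theorems.BalabanUVNodesN19AtSpineCarriers

/-!
# BalabanUVNodes ∕ N20 (NE7b) — AGE ⊛ SCALE AT THE CHAIN LEVEL: the ℓ¹-TRANSPORT EDITION of the scale chain (per-step radii `inj K j · t (K − j)` with an
# ℓ¹ age transport compose to N19's ∃δ-edge), its BAŁABAN-ACTIVITY and TWO-CHANNEL instances, the explicit ℓ¹ constant, and the δ-arithmetic of `NE7.Core`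
# with CRIT-1's positivity guard — P2 + (d) of the crux idea card `age-scale-convolution`, composed into the `h19` currency

Cell `pub-ymgap` (HUMAN RULING D-0062 Track A; work-bound push D-0149, director-ym №197), width seat `pub-ymgap-dag-n20-w1` (gen 4) on node N20 = NE7b; key item K3⁷
`SpineGivenEndpointR13SepCoPH` = stmt-QuantumFields-20544 (`--kind proof --supports 20544 --as helper`); COUNT-NEUTRAL.  Bus: CLAIM-5 ∕ INTENT-9 (INBOX l.28344), CONCEDE +
INTENT-9 RE-POINTED (l.28549: the card's P1 — FirstLemma ∕ SecondLemma ∕ NotGeometric ∕ ThirdLemma — is dag-n19-w1 g3's `…N19AgeScaleTransportBudget` by R455 (A) order; this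
file is the remainder named «yours» there plus its N20 composition).  [III] = [Balaban1988Convergent] (CMP 119), [LF-I] = [Balaban1989LargeFieldI] (CMP 122).

WHY.  In the registered K3⁷ skeleton v5 (plan g82, 941dddb108cbaacf; v4's `Keyed*` texts kept verbatim) the N19′ conjunct of `stub_expansion13H` is `KeyedCoreEdgeHolderD4 β cr rr`: under the crux's prefix,
`∃ δ, NE7.Core … δ ∧ Summable δ` — `δ` EXISTENTIAL, only `Summable δ` consumed.  The N20 census at the reading of record (dag-n20-w2 `…CutZero` ∕ `…OverCut` ∕ `…Canonical`,
this seat's `…PolicyWall` p597932, dag-n19-w1 `…CutTransferAtSpineReading`) leaves the OLD-LARGE-FIELD components INSIDE the good classes at the zero cut: they are MATCHED in the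
core, not booked by weight.  The crux idea card `age-scale-convolution` (ym-nodeO idea-3 g5; evidence n°46∕n°47 on 20544; CRIT-1 g4 triage n°49 «SURVIVES, priced»:
`Cruxes/SpineGivenEndpointR13SepCoPH/CRIT-1-TRIAGE-age-scale-convolution.md`) says in which SUMMABILITY CLASS that channel lives: a component HEALED at age `n = K − j` carries
Bałaban's large-field activity `a n = exp(−(A·log(x₀ + b·n))^{2p₀})` ([III] (1.1) p.244, p.246: `p₀(g) = A₀(log g⁻²)^{p₀}`, `p₀ ≥ 1`; `1∕g² = x₀ + b·n` along the AF trajectory —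
LOCATION only), summable with every moment yet NOT geometric, while the discrepancy injected at SCALE `j` is geometric (`T4CauchySum.InjectedRate`); `K = j + n` makes the
channel an antidiagonal CONVOLUTION.  dag-n19-w2 g2's `…N19CoreScaleChain.coreEdge_scaleChain` composed a FACTOR-BY-FACTOR two-run matching on one history index with per-step
radii `inj K j · ρ^{K−j}` (GEOMETRIC age transport — node U6's `delta`) into N19's ∃δ-edge.  THIS FILE is the ℓ¹-TRANSPORT EDITION of that chain — the age factor `ρ^{K−j}`
replaced by ANY `t (K − j) ≥ 0` with `Σ_n (n+1)^c t n < ∞` — so that a chain whose OLD factors carry Bałaban's activity composes to the edge too (§1), with the two-channel chain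
(young∕small-field factors geometric, old-large-field factors at the activity) as the kernel shape of the card's «stub_sfYoungGeometric · stub_lfBirthChannel · stub_coreOfChannels»;
§2 is the δ-arithmetic of `NE7.Core` the card's P2 (`CoreDeltaSplit`) needs, WITH CRIT-1 §5's positivity guard made explicit: its FAILURE without the guard is a kernel witness,
and the guard itself is N21's face (dag-n20-d `SpineCanonicalWeights.core_nonneg_of_shellWeightBound` BY NAME).
* §0 [folklore] `injectedRate_le_split` ∕ `transportedTotal_le` (the TERMWISE majorant of the transported total by a Cauchy-product term — the one transport lemma not in
  dag-n19-w1's `…N19AgeScaleTransportBudget` (p603780), whose `summable_transportedTotal` ∕ `summable_succ_pow_mul_balabanActivity` ∕ `summable_antidiagonal_of_nonneg` ∕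
  `succ_cast_pow_le_mul_pow` are CITED BY NAME) ∕ `summable_cauchyProduct_profiles`.
* §1 THE ℓ¹-TRANSPORT SCALE CHAIN [folklore]: `sum_range_succ_eq_transportedTotal` · ★★ `core_scaleChain_transport` ∕ `coreEdge_scaleChain_transport` (dag-n19-w2's
  `core_finsetProd_of_levelwise` BY NAME at radii `inj K j · t (K − j)`; edge witness `δ K := Σ_{j+n=K} inj K j · t n`) · ★ `coreEdge_scaleChain_ageActivity` (`t :=` Bałaban's
  activity) · ★★ `coreEdge_twoChannelChain` (SF chain at `injSF K j·ρ^{K−j}` AND LF chain at `injLF K j·t (K−j)` on one index ⇒ ONE edge, bad classes united, factors multiplied,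
  `δ := delta 1 ρ injSF + Σ_{j+n=·} injLF · t` — dag-n19-w2's `core_mul` BY NAME) · `tsum_transportedTotal_le` (the explicit ℓ¹ constant `E·C·(Σ_j (j+1)^c θ^j)·(Σ_n (n+1)^c t n)`).
* §2 THE δ-ARITHMETIC OF `NE7.Core` [folklore]: ★ `exists_core_not_mono_delta` (CRIT-1 §5's witness `P = Q ≡ −1`: dag-n19-a's `N19AtSpineCarriers.core_mono_delta` NEEDS its guard
  `0 ≤ P`; the guard IS N21's face — dag-n20-d `core_nonneg_of_shellWeightBound` BY NAME) · `core_mul_sameBad` (dag-n19-w2's `core_mul` at a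
  common bad class and volume: `Core P₁ Q₁ δ₁ → Core P₂ Q₂ δ₂ → Core (P₁P₂) (Q₁Q₂) (δ₁+δ₂)`) · ★★ `coreEdge_of_channels` (two summable channel sandwiches ⇒ the `h19` currency) ·
  `core_of_split` ∕ `coreEdge_of_split` (the card's `CoreDeltaSplit`, guard displayed).

HONEST FRAMING.  [folklore] finite-sum ∕ series bookkeeping over Mathlib and the tree's SHAPES `T4CauchySum.InjectedRate ∕ delta`, `Spine.NE7.Core` BY NAME; count-neutral;
proves NO estimate of the programme.  The factorwise two-run matchings (§1's `h`, `hSF`, `hLF`), the channel sandwiches of §2 and the activity's letters `A, x₀, b, p₀` are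
HYPOTHESES ∕ LETTERS (the card's K1∕K2∕K3 — XL, unprinted, ownerless; print LOCATED at [III] p.244∕246 by CRIT-1; [LF-I] p.175 «does not give any positive power of ε»);
nothing of Bałaban's is asserted or instantiated — no measure, datum, reading or record object enters this file (A6 declared: the antecedents are inhabited for no Bałaban family
today).  NE7 ∕ NE7b ∕ NE7c NOT PRINTED for `d = 4`, NOT proved; N19 ∕ N20 NOT discharged; K3⁷ NOT closed; counts unmoved (typed 28∕28 · discharged 5∕27); no count claim.
One finite `𝕋⁴_{L^K}` programme at fixed `ε = L^{−K}`, Bałaban AS PRINTED; the YM mass gap (Clay) is NOT proved by any of this — R4 closes the conditional finite-𝕋⁴ rung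
`BalabanLadder.UV` only; NOT ℝ⁴, NOT OS.  No `def`, no `instance`, no `notation`, no `sorry`.  Sources (location only): [III] (1.1) p.244, p.246, (2.18) p.257; [LF-I] p.175;
[King1986] Thm 3.4 (3.9)–(3.13) pp.656–657; [GawedzkiKupiainen1985] (142)–(143) p.20 (as quoted in `T4MatchingAssembly`).
-/

noncomputable section

open Finset Real
open _root_.Filter _root_.Topology _root_.Asymptotics
open scoped BigOperators

namespace Summit.QuantumFields.YangMills.BalabanUVNodes.N20AgeScaleChain

open Literature.MathematicalPhysics.QuantumFieldTheory.Balaban1983to89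
open Literature.MathematicalPhysics.QuantumFieldTheory.Balaban1983to89.T4CauchySum (InjectedRate delta summable_delta summable_succ_pow_mul_geometric)
open Summit.QuantumFields.BalabanUV.T4Continuum.Spine
open Summit.QuantumFields.YangMills.BalabanUVNodes.N19AgeScaleTransportBudget (summable_antidiagonal_of_nonneg succ_cast_pow_le_mul_pow transportedTotal_nonneg
  summable_transportedTotal summable_succ_pow_mul_balabanActivity)
open Summit.QuantumFields.YangMills.BalabanUVNodes.N19CoreScaleChain (core_finsetProd_of_levelwise coreEdge_scaleChain)
open Summit.QuantumFields.YangMills.BalabanUVNodes.N19CoreSkewProduct (core_mul)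
open Summit.QuantumFields.YangMills.BalabanUVNodes.N19CoreProductBlocks (core_of_core_one)
open Summit.QuantumFields.YangMills.BalabanUVNodes.N19AtSpineCarriers (core_mono_delta)

/-! ## §0  The termwise majorant of the transported total (the one transport lemma not in dag-n19-w1's file; used for the explicit ℓ¹ constant of §1) -/

section Transport

variable {E C θ : ℝ} {c : ℕ} {t : ℕ → ℝ} {inj : ℕ → ℕ → ℝ}

/-- On the antidiagonal of `K` an injected rate is dominated TERM BY TERM by the scale profile `(j+1)^c θ^j` times the age moment `(n+1)^c` (dag-n19-w1's
`succ_cast_pow_le_mul_pow` BY NAME splits the asymptotic-freedom polynomial). [folklore] -/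
theorem injectedRate_le_split (hinj : InjectedRate C c θ inj) (hC : 0 ≤ C) (hθ : 0 ≤ θ) {K : ℕ} {p : ℕ × ℕ} (hp : p ∈ antidiagonal K) :
    inj K p.1 ≤ C * (((p.1 : ℝ) + 1) ^ c * θ ^ p.1) * (((p.2 : ℝ) + 1) ^ c) := by
  rw [HasAntidiagonal.mem_antidiagonal] at hp
  have hle : p.1 ≤ K := hp ▸ Nat.le_add_right _ _
  refine ((hinj K p.1 hle).2).trans ?_
  have hK : ((K : ℝ) + 1) ^ c ≤ ((p.1 : ℝ) + 1) ^ c * ((p.2 : ℝ) + 1) ^ c := by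
    have h := succ_cast_pow_le_mul_pow p.1 p.2 c
    rwa [hp] at h
  calc C * ((K : ℝ) + 1) ^ c * θ ^ p.1 ≤ C * (((p.1 : ℝ) + 1) ^ c * ((p.2 : ℝ) + 1) ^ c) * θ ^ p.1 := by gcongr
    _ = C * (((p.1 : ℝ) + 1) ^ c * θ ^ p.1) * (((p.2 : ℝ) + 1) ^ c) := by ring

/-- **TERMWISE MAJORANT**: `E·Σ_{antidiagonal K} inj K j·t n ≤ E·C·Σ_{antidiagonal K} ((j+1)^c θ^j)·((n+1)^c t n)` — a CAUCHY-PRODUCT term of the two profiles (the inequality dag-n19-w1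
inlines in `summable_transportedTotal`; displayed here because §1's explicit ℓ¹ constant needs it per `K`). [folklore] -/
theorem transportedTotal_le (hinj : InjectedRate C c θ inj) (hE : 0 ≤ E) (hC : 0 ≤ C) (hθ : 0 ≤ θ) (ht : ∀ n, 0 ≤ t n) (K : ℕ) :
    E * ∑ p ∈ antidiagonal K, inj K p.1 * t p.2 ≤
      E * C * ∑ p ∈ antidiagonal K, (((p.1 : ℝ) + 1) ^ c * θ ^ p.1) * (((p.2 : ℝ) + 1) ^ c * t p.2) := by
  have hsum : ∑ p ∈ antidiagonal K, inj K p.1 * t p.2 ≤ C * ∑ p ∈ antidiagonal K, (((p.1 : ℝ) + 1) ^ c * θ ^ p.1) * (((p.2 : ℝ) + 1) ^ c * t p.2) := by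
    rw [mul_sum]
    refine sum_le_sum fun p hp => ?_
    calc inj K p.1 * t p.2 ≤ C * (((p.1 : ℝ) + 1) ^ c * θ ^ p.1) * (((p.2 : ℝ) + 1) ^ c) * t p.2 :=
          mul_le_mul_of_nonneg_right (injectedRate_le_split hinj hC hθ hp) (ht _)
      _ = C * ((((p.1 : ℝ) + 1) ^ c * θ ^ p.1) * (((p.2 : ℝ) + 1) ^ c * t p.2)) := by ring
  calc E * ∑ p ∈ antidiagonal K, inj K p.1 * t p.2
      ≤ E * (C * ∑ p ∈ antidiagonal K, (((p.1 : ℝ) + 1) ^ c * θ ^ p.1) * (((p.2 : ℝ) + 1) ^ c * t p.2)) := mul_le_mul_of_nonneg_left hsum hE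
    _ = _ := (mul_assoc _ _ _).symm

/-- The Cauchy product of the two profiles is summable (dag-n19-w1's `summable_antidiagonal_of_nonneg` + `T4CauchySum.summable_succ_pow_mul_geometric` BY NAME). [folklore] -/
theorem summable_cauchyProduct_profiles (hθ : 0 ≤ θ) (hθ1 : θ < 1) (ht : ∀ n, 0 ≤ t n) (hts : Summable fun n : ℕ => ((n : ℝ) + 1) ^ c * t n) :
    Summable fun K : ℕ => ∑ p ∈ antidiagonal K, (((p.1 : ℝ) + 1) ^ c * θ ^ p.1) * (((p.2 : ℝ) + 1) ^ c * t p.2) :=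
  summable_antidiagonal_of_nonneg (f := fun j : ℕ => ((j : ℝ) + 1) ^ c * θ ^ j) (g := fun n : ℕ => ((n : ℝ) + 1) ^ c * t n)
    (summable_succ_pow_mul_geometric hθ hθ1 c) hts (fun j => by positivity) fun n => mul_nonneg (by positivity) (ht n)

end Transport

/-! ## §1  The ℓ¹-transport scale chain (dag-n19-w2's `coreEdge_scaleChain` with `ρ^{K−j}` replaced by an ℓ¹ age transport `t (K − j)`) -/

section Chain

variable {ι : Type*} [DecidableEq ι] {l₀ θ C : ℝ} {c : ℕ} {T : ℕ → Finset ι} {Bad : ℕ → ℕ → ℝ → Finset ι} {P Q : ℕ → ℕ → ℝ → ι → ℝ}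
  {inj : ℕ → ℕ → ℝ} {t : ℕ → ℝ}

/-- the chain radius in the ℓ¹-transport currency: `Σ_{j ∈ range (K+1)} inj K j · t (K − j) = Σ_{(j,n) ∈ antidiagonal K} inj K j · t n`. [folklore] -/
theorem sum_range_succ_eq_transportedTotal (t : ℕ → ℝ) (inj : ℕ → ℕ → ℝ) (K : ℕ) :
    ∑ j ∈ Finset.range (K + 1), inj K j * t (K - j) = ∑ p ∈ antidiagonal K, inj K p.1 * t p.2 := by
  rw [Finset.Nat.sum_antidiagonal_eq_sum_range_succ (fun j n => inj K j * t n) K]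

/-- ★★ **THE ℓ¹-TRANSPORT SCALE CHAIN, EXPLICIT RADIUS.**  At every level `K` the steps `j ≤ K` are each sandwiched on the common index with their own bad class, ONE class-uniform
constant and radius `inj K j · t (K − j)` («injected at scale `j`, transported through its AGE `K − j` by `t`»), run A's good factors nonnegative ⟹ the product weights are
matched with the UNION of the bad classes and the chain radius `δ K = Σ_{j+n=K} inj K j · t n` (dag-n19-w2's `core_finsetProd_of_levelwise` BY NAME).  No summability asked or
given here. [folklore] -/
theorem core_scaleChain_transport
    (h : ∀ K j, j ≤ K → ∃ c₀ : ℝ, ∀ s : ℝ, |s| ≤ l₀ → ∀ τ ∈ T K \ Bad j K s,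
      Real.exp (c₀ - inj K j * t (K - j)) * P j K s τ ≤ Q j K s τ ∧ Q j K s τ ≤ Real.exp (c₀ + inj K j * t (K - j)) * P j K s τ)
    (hP : ∀ K j, j ≤ K → ∀ s, |s| ≤ l₀ → ∀ τ ∈ T K \ Bad j K s, 0 ≤ P j K s τ) :
    NE7.Core l₀ 1 T (fun K s => (Finset.range (K + 1)).biUnion fun j => Bad j K s)
      (fun K s τ => ∏ j ∈ Finset.range (K + 1), P j K s τ) (fun K s τ => ∏ j ∈ Finset.range (K + 1), Q j K s τ)
      (fun K => ∑ p ∈ antidiagonal K, inj K p.1 * t p.2) := by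
  have hle : ∀ {K j}, j ∈ Finset.range (K + 1) → j ≤ K := fun hj => Nat.lt_succ_iff.1 (Finset.mem_range.1 hj)
  have hc := core_finsetProd_of_levelwise (vol := fun _ => (1 : ℝ)) (δ := fun j K => inj K j * t (K - j)) (P := P) (Q := Q) (Bad := Bad)
    (T := T) (l₀ := l₀) (fun K => Finset.range (K + 1))
    (fun K j hj => by simpa only [one_mul] using h K j (hle hj)) fun K j hj => hP K j (hle hj)
  intro K
  obtain ⟨c₀, hc₀⟩ := hc K
  refine ⟨c₀, fun s hs τ hτ => ?_⟩
  have e : ∑ j ∈ Finset.range (K + 1), (1 : ℝ) * (inj K j * t (K - j)) = ∑ p ∈ antidiagonal K, inj K p.1 * t p.2 := by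
    simp only [one_mul]; exact sum_range_succ_eq_transportedTotal t inj K
  simpa only [e] using hc₀ s hs τ hτ

/-- ★★ **THE ℓ¹-TRANSPORT SCALE CHAIN COMPOSES TO N19's ∃δ-EDGE** (the ℓ¹ edition of dag-n19-w2's `coreEdge_scaleChain`): as in `core_scaleChain_transport`, with the birth sizes an
`InjectedRate C c θ inj` (`θ ∈ [0,1[`) and the age transport `t ≥ 0` with `Σ_n (n+1)^c t n < ∞` ⟹ `∃ δ, Core l₀ 1 T (⋃_{j ≤ K} Bad j) (∏ P j) (∏ Q j) δ ∧ Summable δ`, witness the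
chain radius (dag-n19-w1's `summable_transportedTotal` BY NAME — the card's FirstLemma — at `E = 1`).  The geometric chain is the instance `t n = ρⁿ`. [folklore] -/
theorem coreEdge_scaleChain_transport
    (h : ∀ K j, j ≤ K → ∃ c₀ : ℝ, ∀ s : ℝ, |s| ≤ l₀ → ∀ τ ∈ T K \ Bad j K s,
      Real.exp (c₀ - inj K j * t (K - j)) * P j K s τ ≤ Q j K s τ ∧ Q j K s τ ≤ Real.exp (c₀ + inj K j * t (K - j)) * P j K s τ)
    (hP : ∀ K j, j ≤ K → ∀ s, |s| ≤ l₀ → ∀ τ ∈ T K \ Bad j K s, 0 ≤ P j K s τ)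
    (hinj : InjectedRate C c θ inj) (hC : 0 ≤ C) (hθ : 0 ≤ θ) (hθ1 : θ < 1) (ht : ∀ n, 0 ≤ t n) (hts : Summable fun n : ℕ => ((n : ℝ) + 1) ^ c * t n) :
    ∃ δ : ℕ → ℝ, NE7.Core l₀ 1 T (fun K s => (Finset.range (K + 1)).biUnion fun j => Bad j K s)
      (fun K s τ => ∏ j ∈ Finset.range (K + 1), P j K s τ) (fun K s τ => ∏ j ∈ Finset.range (K + 1), Q j K s τ) δ ∧ Summable δ :=
  ⟨_, core_scaleChain_transport h hP,
    (summable_transportedTotal zero_le_one hC hθ hθ1 hinj ht hts).congr fun _ => one_mul _⟩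

/-- ★ **THE CHAIN WHOSE FACTORS AGE AT BAŁABAN's LARGE-FIELD ACTIVITY COMPOSES TO THE EDGE**: per-step radii `inj K j · exp(−(A·log(x₀ + b·(K−j)))^{2p₀})` — a discrepancy
injected at scale `j` (geometric `InjectedRate`) carried by a component of AGE `K − j` at the activity — give `∃ δ, Core … δ ∧ Summable δ` (dag-n19-w1's
`summable_succ_pow_mul_balabanActivity` BY NAME — the card's SecondLemma: the activity has the moment of order `c`; `x₀ = g_∞⁻² > 1`).  This is the summability class the card proposes for the OLD-LARGE-FIELD channel of the N19′ core conjunct;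
that Bałaban's healed components ARE so matched is the card's K1∕K2 (hypothesis `h`, unprinted). [folklore] -/
theorem coreEdge_scaleChain_ageActivity {A x₀ b : ℝ} {p₀ : ℕ}
    (h : ∀ K j, j ≤ K → ∃ c₀ : ℝ, ∀ s : ℝ, |s| ≤ l₀ → ∀ τ ∈ T K \ Bad j K s,
      Real.exp (c₀ - inj K j * Real.exp (-((A * Real.log (x₀ + b * (K - j : ℕ))) ^ (2 * p₀)))) * P j K s τ ≤ Q j K s τ ∧
        Q j K s τ ≤ Real.exp (c₀ + inj K j * Real.exp (-((A * Real.log (x₀ + b * (K - j : ℕ))) ^ (2 * p₀)))) * P j K s τ)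
    (hP : ∀ K j, j ≤ K → ∀ s, |s| ≤ l₀ → ∀ τ ∈ T K \ Bad j K s, 0 ≤ P j K s τ)
    (hinj : InjectedRate C c θ inj) (hC : 0 ≤ C) (hθ : 0 ≤ θ) (hθ1 : θ < 1) (hA : 0 < A) (hx : 1 < x₀) (hb : 0 < b) (hp : 1 ≤ p₀) :
    ∃ δ : ℕ → ℝ, NE7.Core l₀ 1 T (fun K s => (Finset.range (K + 1)).biUnion fun j => Bad j K s)
      (fun K s τ => ∏ j ∈ Finset.range (K + 1), P j K s τ) (fun K s τ => ∏ j ∈ Finset.range (K + 1), Q j K s τ) δ ∧ Summable δ :=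
  coreEdge_scaleChain_transport (t := fun n : ℕ => Real.exp (-((A * Real.log (x₀ + b * n)) ^ (2 * p₀)))) h hP hinj hC hθ hθ1
    (fun _ => (Real.exp_pos _).le) (summable_succ_pow_mul_balabanActivity hA hx hb hp c)

/-- ★★ **THE TWO-CHANNEL CHAIN** (kernel shape of the card's «stub_sfYoungGeometric · stub_lfBirthChannel · stub_coreOfChannels» at the chain level): on ONE history index, a
SMALL-FIELD∕YOUNG factor family matched at GEOMETRIC radii `injSF K j · ρ^{K−j}` (node U6's currency; dag-n19-w2's `coreEdge_scaleChain`) AND an OLD-LARGE-FIELD factor family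
matched at ℓ¹-TRANSPORT radii `injLF K j · t (K − j)` (`coreEdge_scaleChain_transport`), run A's good factors of both families nonnegative ⟹ the FULL product weights are matched
with the union of all bad classes and a SUMMABLE radius (`δ := delta 1 ρ injSF + Σ_{j+n=·} injLF·t`; dag-n19-w2's `core_mul` BY NAME at volume `1`). [folklore] -/
theorem coreEdge_twoChannelChain {ρ CSF CLF θSF θLF : ℝ} {cSF cLF : ℕ} {BadSF BadLF : ℕ → ℕ → ℝ → Finset ι} {PSF QSF PLF QLF : ℕ → ℕ → ℝ → ι → ℝ}
    {injSF injLF : ℕ → ℕ → ℝ}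
    (hSF : ∀ K j, j ≤ K → ∃ c₀ : ℝ, ∀ s : ℝ, |s| ≤ l₀ → ∀ τ ∈ T K \ BadSF j K s,
      Real.exp (c₀ - injSF K j * ρ ^ (K - j)) * PSF j K s τ ≤ QSF j K s τ ∧ QSF j K s τ ≤ Real.exp (c₀ + injSF K j * ρ ^ (K - j)) * PSF j K s τ)
    (hPSF : ∀ K j, j ≤ K → ∀ s, |s| ≤ l₀ → ∀ τ ∈ T K \ BadSF j K s, 0 ≤ PSF j K s τ)
    (hinjSF : InjectedRate CSF cSF θSF injSF) (hθSF : 0 ≤ θSF) (hθSF1 : θSF < 1) (hρ : 0 ≤ ρ) (hρ1 : ρ < 1)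
    (hLF : ∀ K j, j ≤ K → ∃ c₀ : ℝ, ∀ s : ℝ, |s| ≤ l₀ → ∀ τ ∈ T K \ BadLF j K s,
      Real.exp (c₀ - injLF K j * t (K - j)) * PLF j K s τ ≤ QLF j K s τ ∧ QLF j K s τ ≤ Real.exp (c₀ + injLF K j * t (K - j)) * PLF j K s τ)
    (hPLF : ∀ K j, j ≤ K → ∀ s, |s| ≤ l₀ → ∀ τ ∈ T K \ BadLF j K s, 0 ≤ PLF j K s τ)
    (hinjLF : InjectedRate CLF cLF θLF injLF) (hCLF : 0 ≤ CLF) (hθLF : 0 ≤ θLF) (hθLF1 : θLF < 1) (ht : ∀ n, 0 ≤ t n)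
    (hts : Summable fun n : ℕ => ((n : ℝ) + 1) ^ cLF * t n) :
    ∃ δ : ℕ → ℝ, NE7.Core l₀ 1 T
      (fun K s => ((Finset.range (K + 1)).biUnion fun j => BadSF j K s) ∪ (Finset.range (K + 1)).biUnion fun j => BadLF j K s)
      (fun K s τ => (∏ j ∈ Finset.range (K + 1), PSF j K s τ) * ∏ j ∈ Finset.range (K + 1), PLF j K s τ)
      (fun K s τ => (∏ j ∈ Finset.range (K + 1), QSF j K s τ) * ∏ j ∈ Finset.range (K + 1), QLF j K s τ) δ ∧ Summable δ := by
  obtain ⟨δSF, hcSF, hsSF⟩ := coreEdge_scaleChain hSF hPSF hinjSF hθSF hθSF1 hρ hρ1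
  obtain ⟨δLF, hcLF, hsLF⟩ := coreEdge_scaleChain_transport hLF hPLF hinjLF hCLF hθLF hθLF1 ht hts
  have hle : ∀ {K j}, j ∈ Finset.range (K + 1) → j ≤ K := fun hj => Nat.lt_succ_iff.1 (Finset.mem_range.1 hj)
  have nnSF : ∀ (K : ℕ) (s : ℝ), |s| ≤ l₀ → ∀ τ ∈ T K \ (Finset.range (K + 1)).biUnion (fun j => BadSF j K s), 0 ≤ ∏ j ∈ Finset.range (K + 1), PSF j K s τ :=
    fun K s hs τ hτ => Finset.prod_nonneg fun j hj => hPSF K j (hle hj) s hs τ ((N19CoreScaleChain.mem_good_biUnion_iff.1 hτ).2 j hj)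
  have nnLF : ∀ (K : ℕ) (s : ℝ), |s| ≤ l₀ → ∀ τ ∈ T K \ (Finset.range (K + 1)).biUnion (fun j => BadLF j K s), 0 ≤ ∏ j ∈ Finset.range (K + 1), PLF j K s τ :=
    fun K s hs τ hτ => Finset.prod_nonneg fun j hj => hPLF K j (hle hj) s hs τ ((N19CoreScaleChain.mem_good_biUnion_iff.1 hτ).2 j hj)
  refine ⟨fun K => 1 * δSF K + 1 * δLF K, core_mul hcSF hcLF nnSF nnLF, ?_⟩
  simpa only [one_mul] using hsSF.add hsLF

/-- **THE EXPLICIT ℓ¹ CONSTANT** (Young's inequality for the counting measure; the chain radius's total mass): `Σ_K E·Σ_{j+n=K} inj K j·t n ≤ E·C·(Σ_j (j+1)^c θ^j)·(Σ_n (n+1)^c t n)`.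
[folklore] -/
theorem tsum_transportedTotal_le {E : ℝ} (hinj : InjectedRate C c θ inj) (hE : 0 ≤ E) (hC : 0 ≤ C) (hθ : 0 ≤ θ) (hθ1 : θ < 1) (ht : ∀ n, 0 ≤ t n)
    (hts : Summable fun n : ℕ => ((n : ℝ) + 1) ^ c * t n) :
    ∑' K, E * ∑ p ∈ antidiagonal K, inj K p.1 * t p.2 ≤
      E * C * ((∑' j : ℕ, ((j : ℝ) + 1) ^ c * θ ^ j) * ∑' n : ℕ, ((n : ℝ) + 1) ^ c * t n) := by
  have hf := summable_succ_pow_mul_geometric hθ hθ1 c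
  have hprod : (∑' j : ℕ, ((j : ℝ) + 1) ^ c * θ ^ j) * (∑' n : ℕ, ((n : ℝ) + 1) ^ c * t n) =
      ∑' K : ℕ, ∑ p ∈ antidiagonal K, (((p.1 : ℝ) + 1) ^ c * θ ^ p.1) * (((p.2 : ℝ) + 1) ^ c * t p.2) := by
    refine tsum_mul_tsum_eq_tsum_sum_antidiagonal_of_summable_norm ?_ ?_
    · simpa only [Real.norm_eq_abs] using summable_abs_iff.mpr hf
    · simpa only [Real.norm_eq_abs] using summable_abs_iff.mpr hts
  rw [hprod, ← tsum_mul_left]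
  exact Summable.tsum_le_tsum (transportedTotal_le hinj hE hC hθ ht) (summable_transportedTotal hE hC hθ hθ1 hinj ht hts)
    ((summable_cauchyProduct_profiles hθ hθ1 ht hts).mul_left (E * C))

end Chain

/-! ## §2  The δ-arithmetic of `NE7.Core` (the card's P2 `CoreDeltaSplit`, with CRIT-1 §5's positivity guard) -/

section CoreArith

variable {ι : Type*} [DecidableEq ι] {l₀ vol : ℝ} {T : ℕ → Finset ι} {Bad : ℕ → ℝ → Finset ι}

/-- ★ **WITHOUT THE POSITIVITY GUARD, MONOTONICITY OF `Core` IN `δ` FAILS** (CRIT-1 §5's witness, kernel-certified; the guard `0 ≤ P` of dag-n19-a's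
`N19AtSpineCarriers.core_mono_delta` is LOAD-BEARING): one class, no bad class, `vol = l₀ = 1`, cores `P = Q ≡ −1` — `Core … (δ ≡ 0)` holds (`c = 0`) but `Core … (δ ≡ 1)`
would need `e^{c−1} ≥ 1` and `e^{c+1} ≤ 1`.  AT ANY READING CARRYING THE N21 CONJUNCT THE GUARD HOLDS: `ShellWeightBound`'s `sh_le_left` gives `0 ≤ A − shA` on every class
(dag-n20-d `SpineCanonicalWeights.core_nonneg_of_shellWeightBound` BY NAME — not restated). [folklore] -/
theorem exists_core_not_mono_delta :
    ∃ (P Q : ℕ → ℝ → Unit → ℝ) (δ δ' : ℕ → ℝ), (∀ K, δ K ≤ δ' K) ∧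
      NE7.Core 1 1 (fun _ => (Finset.univ : Finset Unit)) (fun _ _ => ∅) P Q δ ∧
      ¬ NE7.Core 1 1 (fun _ => (Finset.univ : Finset Unit)) (fun _ _ => ∅) P Q δ' := by
  refine ⟨fun _ _ _ => -1, fun _ _ _ => -1, fun _ => 0, fun _ => 1, fun _ => zero_le_one, ?_, ?_⟩
  · intro K
    exact ⟨0, fun t _ τ _ => by simp⟩
  · intro h
    obtain ⟨c, hc⟩ := h 0
    obtain ⟨h1, h2⟩ := hc 0 (by simp) () (by simp)
    have e1 : 1 ≤ Real.exp (c - 1 * 1) := by linarith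
    have e2 : Real.exp (c + 1 * 1) ≤ 1 := by linarith
    have e3 : Real.exp (c + 1 * 1) = Real.exp (c - 1 * 1) * Real.exp 2 := by rw [← Real.exp_add]; ring_nf
    have e4 : 1 < Real.exp 2 := by linarith [Real.add_one_lt_exp (by norm_num : (2 : ℝ) ≠ 0)]
    nlinarith [Real.exp_pos (c - 1 * 1)]

/-- **TWO CHANNEL SANDWICHES ON THE SAME CLASSES MULTIPLY** (dag-n19-w2's `core_mul` at a COMMON bad class and volume, `core_of_core_one` BY NAME):
`Core P₁ Q₁ δ₁ → Core P₂ Q₂ δ₂ → Core (P₁·P₂) (Q₁·Q₂) (δ₁ + δ₂)`, run A's cores nonnegative on the good classes. [folklore] -/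
theorem core_mul_sameBad {P₁ Q₁ P₂ Q₂ : ℕ → ℝ → ι → ℝ} {δ₁ δ₂ : ℕ → ℝ} (h₁ : NE7.Core l₀ vol T Bad P₁ Q₁ δ₁) (h₂ : NE7.Core l₀ vol T Bad P₂ Q₂ δ₂)
    (hP₁ : ∀ (K : ℕ) (t : ℝ), |t| ≤ l₀ → ∀ τ ∈ T K \ Bad K t, 0 ≤ P₁ K t τ) (hP₂ : ∀ (K : ℕ) (t : ℝ), |t| ≤ l₀ → ∀ τ ∈ T K \ Bad K t, 0 ≤ P₂ K t τ) :
    NE7.Core l₀ vol T Bad (fun K t τ => P₁ K t τ * P₂ K t τ) (fun K t τ => Q₁ K t τ * Q₂ K t τ) (fun K => δ₁ K + δ₂ K) := by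
  have h := core_mul h₁ h₂ hP₁ hP₂
  refine core_of_core_one ?_
  intro K
  obtain ⟨c₀, hc₀⟩ := h K
  refine ⟨c₀, fun t ht τ hτ => ?_⟩
  have hτ' : τ ∈ T K \ (Bad K t ∪ Bad K t) := by rwa [Finset.union_idempotent]
  simpa only [mul_add] using hc₀ t ht τ hτ'

/-- ★★ **TWO SUMMABLE CHANNELS GIVE THE `h19` CURRENCY** `∃ δ, Core … δ ∧ Summable δ` for the product cores (`δ := δSF + δLF`): the composition `stub_coreOfChannels` of the
card, PROVED in hypothesis form — small-field ∕ young sandwich with `Summable δSF` (node U6's `summable_delta`, or §0's `summable_transportedTotal`) and large-field sandwich with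
`Summable δLF` (dag-n19-w1's `summable_of_lfChannelBound`, the card's ThirdLemma). [folklore] -/
theorem coreEdge_of_channels {P₁ Q₁ P₂ Q₂ : ℕ → ℝ → ι → ℝ} {δSF δLF : ℕ → ℝ} (h₁ : NE7.Core l₀ vol T Bad P₁ Q₁ δSF) (h₂ : NE7.Core l₀ vol T Bad P₂ Q₂ δLF)
    (hP₁ : ∀ (K : ℕ) (t : ℝ), |t| ≤ l₀ → ∀ τ ∈ T K \ Bad K t, 0 ≤ P₁ K t τ) (hP₂ : ∀ (K : ℕ) (t : ℝ), |t| ≤ l₀ → ∀ τ ∈ T K \ Bad K t, 0 ≤ P₂ K t τ)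
    (hSF : Summable δSF) (hLF : Summable δLF) :
    ∃ δ : ℕ → ℝ, NE7.Core l₀ vol T Bad (fun K t τ => P₁ K t τ * P₂ K t τ) (fun K t τ => Q₁ K t τ * Q₂ K t τ) δ ∧ Summable δ :=
  ⟨fun K => δSF K + δLF K, core_mul_sameBad h₁ h₂ hP₁ hP₂, hSF.add hLF⟩

/-- **THE CARD's `CoreDeltaSplit` READ WITH THE GUARD** (dag-n19-a's `core_mono_delta` BY NAME): a sandwich at width `δSF + δLF` serves every `δ ≥ δSF + δLF`, run A's cores
nonnegative, `0 ≤ vol`. [folklore] -/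
theorem core_of_split {P Q : ℕ → ℝ → ι → ℝ} {δ δSF δLF : ℕ → ℝ} (h : NE7.Core l₀ vol T Bad P Q fun K => δSF K + δLF K) (hvol : 0 ≤ vol)
    (hP : ∀ (K : ℕ) (t : ℝ), |t| ≤ l₀ → ∀ τ ∈ T K \ Bad K t, 0 ≤ P K t τ) (hle : ∀ K, δSF K + δLF K ≤ δ K) : NE7.Core l₀ vol T Bad P Q δ :=
  core_mono_delta hvol hP hle h

/-- … and with both halves summable the split width itself is the `h19` witness. [folklore] -/
theorem coreEdge_of_split {P Q : ℕ → ℝ → ι → ℝ} {δSF δLF : ℕ → ℝ} (h : NE7.Core l₀ vol T Bad P Q fun K => δSF K + δLF K)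
    (hSF : Summable δSF) (hLF : Summable δLF) : ∃ δ : ℕ → ℝ, NE7.Core l₀ vol T Bad P Q δ ∧ Summable δ :=
  ⟨fun K => δSF K + δLF K, h, hSF.add hLF⟩

end CoreArith

end Summit.QuantumFields.YangMills.BalabanUVNodes.N20AgeScaleChain
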